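import Literature.AnabelianGeometry.AbsoluteAnabelian.AbsTopII.TwoTripodNodalNode
import Literature.AnabelianGeometry.AbsoluteAnabelian.AbsTopII.InertiaDecompositionMoreoverProofs
import HarnessLib

/-!
# [AbsTopII] Prop 1.3 (iv) «Moreover» at the two-vertex nodal DPSC datum, and the summary

S. Mochizuki, *Topics in Absolute Anabelian Geometry II* [AbsTopII] (bib `MochizukiAbsTopII2013`; locators =
PDF pages of the kurims manuscript `paper:url-585b8d0ad0d9`), §1 Prop 1.3 (iv) pp. 11–12 (proof pp. 13–15),
(v) p. 12, (vii) p. 12; [CombGC] (`MochizukiCombGC2007`) Prop 1.2 (ii) p. 8.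

PROOF-ONLY companion of `AbsTopII/TwoTripodNodalDatum.lean` (abc-iut-f-066 gen 5, row «P13-TWO-VERTEX-NODAL-MODEL»),
part 3/3 (over `TwoTripodNodalInertia.lean`, `TwoTripodNodalNode.lean`).  At `M.dpsc` (two tripods `v_A`, `v_B`,
ONE non-loop node, `I ≅ Ẑ^Σ` acting by the Dehn twist; every `Σ`):

* `prop13iv_moreover_dpsc` — **the «Moreover» clause of Prop 1.3 (iv) (`Prop13iv_moreover`) HOLDS with situation
  (2) NON-VACUOUS** (two distinct adjacent vertices joined by the node), no hypothesis: abc-iut-f-069's closer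
  `prop13iv_moreover_of_inputs` with every printed input discharged at the datum — branch configuration
  (conjugating elements `1`, `I_{v_A} ⊔ I_{v_B} = I_e`); `I_e ∩ Π_𝔾 = Π_e`; `I_v ↠ I`; `D_v ∩ Π_I ⊆ Z(I_v)`
  (`normalizer_le_centralizer_centralizer`: the commutator `[x, i]` dies in `I_v ∩ Π_𝔾 = 1` via the retraction
  `P → T`); `C(Π_e) ∩ Π_I ⊆ I_e` and `D_v ∩ Π_𝔾 = Π_v` (free-factor commensurable terminality); the CLAIM for
  non-adjacent vertices is vacuous on this graph;
* `exists_twoVertex_nodal_model` — **ONE DPSC datum WITH TWO VERTICES carrying the typed (i) ∧ (ii)′ ∧ (iii) ∧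
  (iii)′ ∧ (iv)′ ∧ (iv)-«Moreover», for every nonempty set of primes `Σ`.**

HONEST FRAMING: instance at a constructed datum (constructed ≠ geometric); no hypothesis; no side taken on
[IUTchIII] Cor 3.12; typed ≠ proved for the print statements about all stable log curves.
-/

noncomputable section

open scoped Pointwise

namespace Literature.AnabelianGeometry.AbsoluteAnabelian.AbsTopII.TwoTripodNodal.Model

open Literature.AnabelianGeometry.SemiGraphs
open Literature.AnabelianGeometry.SemiGraphs.SemiGraphOfAnabelioids (IsProSigmaCompletion)
open Literature.AnabelianGeometry.SemiGraphs.SemiGraphOfAnabelioids.IsProSigmaCompletion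
open Literature.AnabelianGeometry.Anabelioids (IsSigmaInteger normalizer_le_commensurator)
open Literature.GroupTheory.CombinatorialGroupTheory
open Literature.GroupTheory.CombinatorialGroupTheory.PuncturedSurfaceGroup
open _root_.Topology

variable {Sigma : Set ℕ} (M : Model Sigma)

/-! ### The «Moreover» clause of Prop 1.3 (iv) -/

/-- Input «`D_v ∩ Π_I ⊆ Z_{Π_I}(I_v)`» in `P`: for a subgroup `V` with `(Z(V) ∩ P) ∩ Π_𝔾 = {1}`, every
`x ∈ N(V)` centralises `Z(V)` — the commutator `[x, i]` (`i ∈ Z(V)`) lies in `Z(V)` (normalisers preserve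
centralisers) and in `Π_𝔾 = Ker(P → T)` (`T` abelian). [cite: MochizukiAbsTopII2013, Prop 1.3 (v) p.12] -/
theorem normalizer_le_centralizer_centralizer (V : Subgroup M.P)
    (hV : (Subgroup.centralizer (V : Set M.P) ⊓ ⊤) ⊓ M.PiG = ⊥) :
    Subgroup.normalizer (V : Set M.P) ⊓ ⊤ ≤
      Subgroup.centralizer (((Subgroup.centralizer (V : Set M.P) ⊓ ⊤ : Subgroup M.P)) : Set M.P) := by
  intro x hx
  have hxD : x ∈ Subgroup.normalizer (V : Set M.P) := (Subgroup.mem_inf.mp hx).1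
  rw [Subgroup.mem_centralizer_iff]
  intro i hi
  have hiZ : i ∈ Subgroup.centralizer (V : Set M.P) := (Subgroup.mem_inf.mp hi).1
  obtain ⟨F, -, -, hFT, hFA⟩ := SemidirectCofinal.exists_retraction M.φ (P := M.P) M.isProSigmaCompletion
  have hab : F x * F i = F i * F x :=
    Subtype.ext (M.isFreeProSigmaCyclic_T.subgroup_comm _ (F x).2 _ (F i).2)
  -- the commutator lies in `Π_𝔾`
  have hcommG : x * i * x⁻¹ * i⁻¹ ∈ M.PiG := by
    have h1 : F (x * i * x⁻¹ * i⁻¹) = 1 := by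
      rw [map_mul, map_mul, map_mul, map_inv, map_inv, hab]
      group
    exact (SemidirectCofinal.retraction_eq_one_iff M.φ M.isProSigmaCompletion hFT hFA _).mp h1
  -- the conjugate `x i x⁻¹` lies in `Z(V)`
  have hconj : x * i * x⁻¹ ∈ (Subgroup.centralizer (V : Set M.P) ⊓ ⊤ : Subgroup M.P) := by
    refine Subgroup.mem_inf.mpr ⟨?_, Subgroup.mem_top _⟩
    rw [Subgroup.mem_centralizer_iff]
    intro s hs
    have hs' : x⁻¹ * s * x ∈ V := by
      refine (Subgroup.mem_normalizer_iff.mp hxD (x⁻¹ * s * x)).mpr ?_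
      rw [show x * (x⁻¹ * s * x) * x⁻¹ = s by group]
      exact hs
    have hc := (Subgroup.mem_centralizer_iff.mp hiZ) _ hs'
    calc s * (x * i * x⁻¹) = x * ((x⁻¹ * s * x) * i) * x⁻¹ := by group
      _ = x * (i * (x⁻¹ * s * x)) * x⁻¹ := by rw [hc]
      _ = x * i * x⁻¹ * s := by group
  have hcommI : x * i * x⁻¹ * i⁻¹ ∈ (Subgroup.centralizer (V : Set M.P) ⊓ ⊤ : Subgroup M.P) :=
    Subgroup.mul_mem _ hconj (Subgroup.inv_mem _ hi)
  have h1 : x * i * x⁻¹ * i⁻¹ = 1 := by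
    rw [← Subgroup.mem_bot, ← hV]
    exact Subgroup.mem_inf.mpr ⟨hcommI, hcommG⟩
  have : x * i = i * x := by
    rw [mul_inv_eq_one, mul_inv_eq_iff_eq_mul] at h1
    exact h1
  exact this.symm

/-- Input «`D_v ∩ Π_I ⊆ Z_{Π_I}(I_v)`» at the datum, in DPSC form. [cite: MochizukiAbsTopII2013, Prop 1.3 (v) p.12] -/
theorem Dv_le_centralizer_Iv (hne : Sigma.Nonempty) (hprime : ∀ p ∈ Sigma, p.Prime) (v : (M.dpsc hne hprime).Vert) :
    (M.dpsc hne hprime).Dv v ⊓ (M.dpsc hne hprime).PiI ≤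
      Subgroup.centralizer (((M.dpsc hne hprime).Iv v : Subgroup (M.dpsc hne hprime).PiH) :
        Set (M.dpsc hne hprime).PiH) :=
  M.normalizer_le_centralizer_centralizer (((M.pscDatum hne hprime).vertGp v.down).map M.PiG.subtype)
    (M.Iv_inf_PiG_eq_bot hne hprime v)

/-- Input «`C(Π_e) ⊆ I_e = W · T`» at the datum, in `P`: `x = a·t` with `a ∈ Π_𝔾`, `t ∈ T ⊆ Z(W)`; `t`
commensurates `W`, so `a ∈ C(W) ∩ Π_𝔾 = W` ([CombGC] Prop 1.2 (ii)). [cite: MochizukiAbsTopII2013, Prop 1.3 (vii) p.12] -/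
theorem commensurator_W_le_WT (hne : Sigma.Nonempty) (hprime : ∀ p ∈ Sigma, p.Prime) (x : M.P)
    (hx : x ∈ Subgroup.Commensurable.commensurator ((M.nodeGp).map M.PiG.subtype)) :
    x ∈ (M.nodeGp).map M.PiG.subtype ⊔ M.T := by
  haveI : M.PiG.Normal := M.normal_PiG
  have hCT' : Subgroup.Commensurable.commensurator ((M.nodeGp).map M.PiG.subtype) ⊓ M.PiG.subtype.range ≤
      (M.nodeGp).map M.PiG.subtype :=
    (isCommensurablyTerminal_subgroupOf_iff ((M.dpsc hne hprime).nodeSub_le ⟨()⟩)).mp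
      (M.isCommensurablyTerminal_nodeSub hne hprime ⟨()⟩)
  rw [Subgroup.range_subtype] at hCT'
  have hx' : x ∈ ((M.PiG ⊔ M.T : Subgroup M.P) : Set M.P) := by rw [M.PiG_sup_T]; exact Subgroup.mem_top x
  rw [Subgroup.normal_mul] at hx'
  obtain ⟨a, ha, t, ht, rfl⟩ := Set.mem_mul.mp hx'
  refine Subgroup.mul_mem _ (Subgroup.mem_sup_left ?_) (Subgroup.mem_sup_right ht)
  have htZ : t ∈ Subgroup.centralizer (((M.nodeGp).map M.PiG.subtype : Subgroup M.P) : Set M.P) := by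
    rw [Subgroup.mem_centralizer_iff]
    intro a ha
    exact M.W_commute_T a ha t ht
  have htC : t ∈ Subgroup.Commensurable.commensurator ((M.nodeGp).map M.PiG.subtype) :=
    normalizer_le_commensurator _ (Subgroup.centralizer_le_normalizer _ htZ)
  have haC : a ∈ Subgroup.Commensurable.commensurator ((M.nodeGp).map M.PiG.subtype) := by
    have := Subgroup.mul_mem _ hx (Subgroup.inv_mem _ htC)
    rwa [mul_inv_cancel_right] at this
  exact hCT' ⟨haC, ha⟩

/-- Input «`C_{Π_I}(Π_e) ⊆ I_e`» in DPSC form. [cite: MochizukiAbsTopII2013, Prop 1.3 (vii) p.12] -/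
theorem commensurator_nodeSub_le_IvNode (hne : Sigma.Nonempty) (hprime : ∀ p ∈ Sigma, p.Prime) (e : (M.dpsc hne hprime).Node) :
    Subgroup.Commensurable.commensurator ((M.dpsc hne hprime).nodeSub e) ⊓ (M.dpsc hne hprime).PiI ≤
      (M.dpsc hne hprime).IvNode e := by
  intro x hx
  rw [IvNode_eq_J]
  exact M.commensurator_W_le_WT hne hprime x (Subgroup.mem_inf.mp hx).1

/-- Input «`D_v ∩ Π_𝔾 = Π_v`» at the datum ([CombGC] Prop 1.2 (ii): `N(Π_v) ∩ Π_𝔾 = Π_v`).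
[cite: MochizukiAbsTopII2013, Prop 1.3 (v) p.12] -/
theorem Dv_inf_PiG (hne : Sigma.Nonempty) (hprime : ∀ p ∈ Sigma, p.Prime) (v : (M.dpsc hne hprime).Vert) :
    (M.dpsc hne hprime).Dv v ⊓ (M.dpsc hne hprime).PiG = (M.dpsc hne hprime).vertSub v :=
  normalizer_inf_eq_of_ctIn ((M.dpsc hne hprime).vertSub_le v)
    ((isCommensurablyTerminal_subgroupOf_iff ((M.dpsc hne hprime).vertSub_le v)).mp
      (M.isCommensurablyTerminal_vertSub hne hprime v))

/-- `I_{v} ⊔ I_{v′} = I_e` for the two distinct vertices. [cite: MochizukiAbsTopII2013, Prop 1.3 (ii) p.11] -/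
theorem Iv_sup_Iv_eq_IvNode (hne : Sigma.Nonempty) (hprime : ∀ p ∈ Sigma, p.Prime) (e : (M.dpsc hne hprime).Node) {v v' : (M.dpsc hne hprime).Vert} (hvv : v ≠ v') :
    (M.dpsc hne hprime).Iv v ⊔ (M.dpsc hne hprime).Iv v' = (M.dpsc hne hprime).IvNode e := by
  rw [IvNode_eq_J]
  rcases M.vert_cases hne hprime v with rfl | rfl <;> rcases M.vert_cases hne hprime v' with rfl | rfl
  · exact absurd rfl hvv
  · rw [Iv_eq_T, Iv_eq_U]; exact M.T_sup_U_eq_WT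
  · rw [Iv_eq_T, Iv_eq_U, sup_comm]; exact M.T_sup_U_eq_WT
  · exact absurd rfl hvv

/-- **[AbsTopII] Prop 1.3 (iv), the «Moreover» clauses (`Prop13iv_moreover`) HOLD at the two-vertex nodal datum
— situation (2) NON-VACUOUS (two distinct adjacent vertices joined by the node), no hypothesis**: abc-iut-f-069's
closer `prop13iv_moreover_of_inputs` with every printed input discharged at the datum (branch configuration with
conjugating elements `1`; `I_e ∩ Π_𝔾 = Π_e`; `I_v ↠ I`; `D_v ∩ Π_I ⊆ Z(I_v)`; `C(Π_e) ∩ Π_I ⊆ I_e`;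
`D_v ∩ Π_𝔾 = Π_v`; the CLAIM for non-adjacent vertices is vacuous). [cite: MochizukiAbsTopII2013, Prop 1.3 (iv) p.12] -/
theorem prop13iv_moreover_dpsc (hne : Sigma.Nonempty) (hprime : ∀ p ∈ Sigma, p.Prime) :
    Literature.AnabelianGeometry.AbsoluteAnabelian.DPSCData.Prop13iv_moreover (M.dpsc hne hprime).toDPSCData := by
  refine (M.dpsc hne hprime).toDPSCData.prop13iv_moreover_of_inputs (M.prop13iv'_dpsc hne hprime)
    (fun v v' e hvv _ _ => ⟨1, 1, Subgroup.one_mem _, Subgroup.one_mem _, ?_, ?_, ?_, ?_, ?_⟩)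
    (fun e => ((M.prop_1_3_ii'_dpsc hne hprime) e).1.2.1) (fun v => ((M.prop13iii_dpsc hne hprime) v).2)
    (M.Dv_le_centralizer_Iv hne hprime) (M.commensurator_nodeSub_le_IvNode hne hprime) (M.Dv_inf_PiG hne hprime)
    (fun v v' γ _ hnadj _ => absurd (M.adjacent_dpsc hne hprime v v') hnadj)
  · rw [map_one, one_smul]; exact M.nodeSub_le_vertSub hne hprime e v
  · rw [map_one, one_smul]; exact M.nodeSub_le_vertSub hne hprime e v'
  · rw [map_one, one_smul]; exact M.Iv_le_IvNode hne hprime e v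
  · rw [map_one, one_smul]; exact M.Iv_le_IvNode hne hprime e v'
  · rw [map_one, one_smul, one_smul, M.Iv_sup_Iv_eq_IvNode hne hprime e hvv, Subgroup.relIndex_self]
    exact one_ne_zero

/-! ### Summary: one datum, two vertices, six typed clauses -/

/-- **ONE DPSC datum WITH TWO VERTICES carries the typed [AbsTopII] Prop 1.3 (i) ∧ (ii)′ ∧ (iii) ∧ (iii)′ ∧ (iv)′ ∧
(iv)-«Moreover» simultaneously, for every nonempty set of primes `Σ`** — the degenerating 4-pointed sphere
over the log point (two tripods, one node, four cusps, `I ≅ Ẑ^Σ` acting by the Dehn twist).  Constructed ≠ geometric;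
no side taken on [IUTchIII] Cor 3.12. [cite: MochizukiAbsTopII2013, Prop 1.3 p.11] -/
theorem exists_twoVertex_nodal_model (Sigma : Set ℕ) (hne : Sigma.Nonempty) (hprime : ∀ p ∈ Sigma, p.Prime) :
    ∃ X : DPSCIndexData.{0}, X.Sigma = Sigma ∧ (∃ v v' : X.Vert, v ≠ v' ∧ X.Adjacent v v') ∧ Nonempty X.Node ∧
      Literature.AnabelianGeometry.AbsoluteAnabelian.AbsTopII.DPSCIndexData.Prop_1_3_i X ∧
      Literature.AnabelianGeometry.AbsoluteAnabelian.AbsTopII.DPSCIndexData.Prop_1_3_ii' X ∧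
      Literature.AnabelianGeometry.AbsoluteAnabelian.DPSCData.Prop13iii X.toDPSCData ∧
      Literature.AnabelianGeometry.AbsoluteAnabelian.AbsTopII.DPSCIndexData.Prop_1_3_iii' X ∧
      Literature.AnabelianGeometry.AbsoluteAnabelian.DPSCData.Prop13iv' X.toDPSCData ∧
      Literature.AnabelianGeometry.AbsoluteAnabelian.DPSCData.Prop13iv_moreover X.toDPSCData := by
  obtain ⟨M⟩ := Model.nonempty Sigma
  exact ⟨M.dpsc hne hprime, rfl, ⟨⟨(0 : Fin 2)⟩, ⟨(1 : Fin 2)⟩, M.vert_zero_ne_one hne hprime, M.adjacent_dpsc hne hprime _ _⟩,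
    ⟨⟨()⟩⟩, M.prop_1_3_i_dpsc hne hprime, M.prop_1_3_ii'_dpsc hne hprime, M.prop13iii_dpsc hne hprime,
    M.prop_1_3_iii'_dpsc hne hprime, M.prop13iv'_dpsc hne hprime, M.prop13iv_moreover_dpsc hne hprime⟩

end Literature.AnabelianGeometry.AbsoluteAnabelian.AbsTopII.TwoTripodNodal.Model

end
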